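import Mathlib
import Summits.KontsevichZagierPeriods.Zeta5Search.LaiDenominators
import Literature.NumberTheory.Transcendental.ZudilinLemma19
import HarnessLib

/-!
# ζ(5) search — the saving factor of Lai's box function: `Φ`-upgrade of the denominators, prime by prime
# (fam-indep, κ₃ ladder: the L1 / Φ̃ input, step 5 = [Lai2024BallRivoal, Lemmas 4.3–4.4])

HONEST FRAMING: systematic search; no irrationality claim unless certified.

OUR work (Summit side; cell `pub-zeta5`, family `indep`, planner seat gen 4, STAGED for the lane). Continues
`LaiBricks.lean` → `LaiBrickCoefficients.lean` → `LaiDenominators.lean`. For an EXPONENT TABLE `e : ℕ → ℕ → ℕ` let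
`Φ_e(n) := ∏ p^{e n p}` over the primes `J ≤ p ≤ (M−2·dmin)n` with `Mn < p²` (`laiPhiGen`); call the table ADMISSIBLE
(`LaiExpAdmissible`) if `e n p ≤ φ̃(n/p, k/p)` (`laiPhiDiv`, the telescoped brick exponent of `LaiBricks.lean`) for every
pole index `k ∈ [dmin·n, (M−dmin)n]`. THEN (`laiCoef_isInt_phi`, `laiCoef_dvd3_phi`):
`C_n · ∏_j D_{M_j n} · Φ_e(n)⁻¹ · laiCoef n s ∈ ℤ` for all `n, s`, and `∈ D_{(M−δ₂)n}^3 ℤ` for `s ≥ 3` — LITERALLY the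
`isInt` / `dvd3` fields of the κ₃-ladder skeleton `LaiBoxInputs` (staged `LaiBoxInputs.lean`) with `C n = laiC`,
`Dm j = max(M−2·dmin, M−δ_j)`, `Φ = laiPhiGen J M dmin e`, after `unfold normaliser blockDenom`. Proof: for the primes
of `Φ_e`, `ord_p(C_n c_{s−1,k}) ≥ φ̃ − (J−s)` (`lai_pf_padicOrdGe` ← `laiG_isDOrd` + `divDeriv_laiG_eq`; the condition
`J ≤ p` makes `1/(J−s)!` a `p`-unit), `ord_p D_{M_j n} = 1` (`p ≤ M_j n ≤ Mn < p²`), `ord_p H_k^{(i)} ≥ −i` (`k < p²`); for the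
other primes `ord_p Φ_e = 0` and the `Φ = 1` statements of `LaiDenominators.lean` apply (`Rat.exists_int_of_padicOrdGe`).
Lai's `Φ̃_n` ([Lai2024BallRivoal, (4.5)–(4.6), §13]) is `Φ_e` for `e n p = φ̃(n/p) := min_y φ̃(n/p, y)` restricted to `p ≥ J`
(a restriction that bites only for `n ≤ J²/M` and does not change the rate `ϖ̃`); that table is admissible BY DEFINITION,
so the successor only has to DEFINE it and prove its rate — the arithmetic is finished here for every admissible table.

Everything here is PROVED (0 sorries) for arbitrary parameters; nothing is a named fact; no rate or irrationality
statement. Kernel status: checked on the farm as the tail of ONE file `LaiBricks ++ LaiBrickCoefficients ++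
LaiDenominators ++ this file` (`lean check --json` rc 0 / 0 errors / 0 warnings / 0 sorries); as a separate module it
elaborates verbatim once `Zeta5Search/LaiDenominators.lean` is in the tree.

References: [Lai2024BallRivoal] L. Lai, arXiv:2407.14236, §4 (4.5)–(4.12), Lemmas 4.3–4.4, §13; [Zudilin2004] W. Zudilin,
J. Théor. Nombres Bordeaux 16 (2004), §8 (8.8)–(8.12), Lemma 19 (tree `ZudilinLemma19.lean`, whose `p`-adic helper
lemmas `Zudilin2004.padicValNat_lcmUpto*`, `padicValNat_prod_prime_pow`, `padicOrdGe_inv_natCast` are reused by name).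
-/

noncomputable section

open Finset Filter Literature.NumberTheory.Transcendental Literature.Analysis.Calculus
open scoped Nat

namespace Summit.KontsevichZagierPeriods.Zeta5Search

section Saving

open Polynomial
open Literature.NumberTheory.Transcendental.BallRivoal (harm)

/-! ## The saving factor: `Φ`-type upgrade of `isInt` / `dvd3`, prime by prime ([Lai2024BallRivoal, Lemma 4.3–4.4])

For an EXPONENT TABLE `e : ℕ → ℕ → ℕ` put `Φ_e(n) := ∏ p^{e n p}` over the primes `p` with `J ≤ p ≤ (M−2·dmin)n` and
`Mn < p²` (`laiPhiGen`). If the table is ADMISSIBLE — `e n p ≤ φ̃(n/p, k/p)` (`laiPhiDiv`) for every pole index `k` of the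
window `[dmin·n, (M−dmin)n]` (`LaiExpAdmissible`) — then `C_n ∏_j D_{M_j n} Φ_e(n)⁻¹ · laiCoef n s ∈ ℤ` for all `n, s` and
`∈ D_{(M−δ₂)n}^3 ℤ` for `s ≥ 3`: for the primes of `Φ_e` by the `p`-adic brick estimate `laiG_isDOrd` (+ `ord_p D_N = 1` for
`p ≤ N < p²`, `ord_p H_k^{(i)} ≥ −i` for `k < p²`), for the other primes by the `Φ = 1` statements. Lai's `Φ̃_n` of §13 is
`Φ_e` for the table `e n p = φ̃(n/p) = min_y φ̃(n/p, y)` (admissible by definition); the successor supplies that table and its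
rate `ϖ̃` — the arithmetic is finished here for ANY admissible table. The extra condition `J ≤ p` (needed for `1/j!`,
`j ≤ J−1`) only removes finitely many primes for `n ≤ J²/M` and does not affect rates. -/

/-- A `Φ`-type saving factor built from an exponent table `e` on the primes `J ≤ p ≤ (M−2·dmin)n`, `Mn < p²`. [this file] -/
def laiPhiGen (J M dmin : ℕ) (e : ℕ → ℕ → ℕ) (n : ℕ) : ℕ :=
  ∏ p ∈ (range ((M - 2 * dmin) * n + 1)).filter (fun p => p.Prime ∧ J ≤ p ∧ M * n < p ^ 2), p ^ e n p

/-- Admissibility of an exponent table: `e n p ≤ φ̃(n/p, k/p)` on the pole window, for the primes of `laiPhiGen`. [this file] -/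
def LaiExpAdmissible (J r M : ℕ) (δ : Fin J → ℕ) (dmin : ℕ) (e : ℕ → ℕ → ℕ) : Prop :=
  ∀ n p k : ℕ, p.Prime → J ≤ p → p ≤ (M - 2 * dmin) * n → M * n < p ^ 2 →
    dmin * n ≤ k → k ≤ (M - dmin) * n → ((e n p : ℕ) : ℤ) ≤ laiPhiDiv J r M n δ k p

/-- `Φ_e(n) > 0`. [this file] -/
theorem laiPhiGen_pos (J M dmin : ℕ) (e : ℕ → ℕ → ℕ) (n : ℕ) : 0 < laiPhiGen J M dmin e n :=
  prod_pos fun _ hq => pow_pos (mem_filter.1 hq).2.1.pos _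

/-- `ord_p Φ_e(n) = e n p` for the primes of `Φ_e`, `= 0` otherwise. [this file] -/
theorem padicValNat_laiPhiGen (J M dmin : ℕ) (e : ℕ → ℕ → ℕ) (n p : ℕ) [hp : Fact p.Prime] :
    padicValNat p (laiPhiGen J M dmin e n) =
      if J ≤ p ∧ p ≤ (M - 2 * dmin) * n ∧ M * n < p ^ 2 then e n p else 0 := by
  unfold laiPhiGen
  rw [Zudilin2004.padicValNat_prod_prime_pow _ (fun q hq => (mem_filter.1 hq).2.1)]
  have : (p ∈ (range ((M - 2 * dmin) * n + 1)).filter fun q => q.Prime ∧ J ≤ q ∧ M * n < q ^ 2)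
      ↔ (J ≤ p ∧ p ≤ (M - 2 * dmin) * n ∧ M * n < p ^ 2) := by
    simp only [mem_filter, mem_range]
    constructor
    · rintro ⟨h1, -, h2, h3⟩; exact ⟨h2, by omega, h3⟩
    · rintro ⟨h1, h2, h3⟩; exact ⟨by omega, hp.out, h1, h3⟩
  by_cases h : J ≤ p ∧ p ≤ (M - 2 * dmin) * n ∧ M * n < p ^ 2
  · rw [if_pos (this.2 h), if_pos h]
  · rw [if_neg (fun h' => h (this.1 h')), if_neg h]

/-- `ord_p(−q) ≥ v ↔ ord_p q ≥ v`. [folklore] -/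
theorem padicOrdGe_neg {p : ℕ} {v : ℤ} {q : ℚ} (h : PadicOrdGe p v q) : PadicOrdGe p v (-q) := by
  rcases h with rfl | h
  · rw [neg_zero]; exact PadicOrdGe.zero v
  · exact Or.inr (by rwa [padicValRat.neg])

/-- `ord_p H_k^{(i)} ≥ −i·ord_p D_k` for `harm i k = Σ_{m<k} 1/(m+1)^i`. [cite: Zudilin2004, §8 Lemma 19 (proof)] -/
theorem padicOrdGe_harm {p : ℕ} [hp : Fact p.Prime] (i k : ℕ) :
    PadicOrdGe p (-((i * padicValNat p (Nat.lcmUpto k) : ℕ) : ℤ)) (harm i k) := by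
  unfold harm
  refine PadicOrdGe.sum fun m hm => ?_
  have hm' := mem_range.1 hm
  have hle : padicValNat p (m + 1) ≤ padicValNat p (Nat.lcmUpto k) := by
    have hdvd : m + 1 ∣ Nat.lcmUpto k := dvd_lcmUpto (by omega) (by omega)
    exact (padicValNat_dvd_iff_le (Nat.lcmUpto_pos k).ne').1 (pow_padicValNat_dvd.trans hdvd)
  refine Or.inr ?_
  rw [show ((m : ℚ) + 1) = ((m + 1 : ℕ) : ℚ) by push_cast; ring, one_div, padicValRat.inv, padicValRat.pow,
    padicValRat.of_nat]
  have : (i : ℤ) * padicValNat p (m + 1) ≤ i * padicValNat p (Nat.lcmUpto k) := by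
    exact_mod_cast Nat.mul_le_mul_left i hle
  simp only [Nat.cast_mul]
  linarith

/-- For the primes of `Φ_e`: `ord_p ∏_j D_{M_j n} = J` (each `ord_p D_{M_j n} = 1` as `p ≤ M_j n ≤ Mn < p²`). [this file] -/
theorem lai_padicOrdGe_blockDenom (J M n : ℕ) (δ : Fin J → ℕ) (dmin : ℕ) {p : ℕ} [hp : Fact p.Prime]
    (hp1 : p ≤ (M - 2 * dmin) * n) (hp2 : M * n < p ^ 2) :
    PadicOrdGe p (J : ℤ) (∏ j : Fin J, ((Nat.lcmUpto (max (M - 2 * dmin) (M - δ j) * n) : ℕ) : ℚ)) := by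
  have hj : ∀ j ∈ (univ : Finset (Fin J)),
      PadicOrdGe p 1 ((Nat.lcmUpto (max (M - 2 * dmin) (M - δ j) * n) : ℕ) : ℚ) := fun j _ => by
    refine Or.inr (le_of_eq ?_)
    rw [padicValRat.of_nat]
    have h1 : p ≤ max (M - 2 * dmin) (M - δ j) * n := hp1.trans (Nat.mul_le_mul_right n (le_max_left _ _))
    have h2 : max (M - 2 * dmin) (M - δ j) * n < p ^ 2 :=
      lt_of_le_of_lt (Nat.mul_le_mul_right n (max_le (Nat.sub_le _ _) (Nat.sub_le _ _))) hp2
    rw [Zudilin2004.padicValNat_lcmUpto_eq_one h1 h2]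
    simp
  have h := PadicOrdGe.prod hj
  simpa using h

/-- **(4.12) of [Lai2024BallRivoal]**: for a prime `p ≥ J` with `Mn < p²` and a pole index `k` of the window,
`ord_p (C_n · c_{s−1,k}) ≥ φ̃(n/p, k/p) − (J − s)`. [cite: Lai2024BallRivoal, Lemma 4.3 (4.12)] -/
theorem lai_pf_padicOrdGe (J r M n : ℕ) (δ : Fin J → ℕ) (hδ : ∀ j, 2 * δ j ≤ M) (hM : 0 < M) {c : ℕ → ℕ → ℚ}
    (hc : ∀ t : ℚ, (∀ p : ℕ, p ≤ M * n → t + p + 1 ≠ 0) →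
      BallRivoal.pfEval (M * n) J c t =
        ((laiPoly J r M n δ).comp (X + C 1)).eval t / BallRivoal.poch (t + 1) (M * n + 1) ^ J)
    (dmin : ℕ) (hmin : ∀ j, dmin ≤ δ j) (h2 : 2 * dmin < M) {p : ℕ} [hp : Fact p.Prime] (hJp : J ≤ p)
    (hp2 : M * n < p ^ 2) {k : ℕ} (hk₁ : dmin * n ≤ k) (hk₂ : k ≤ (M - dmin) * n) {s : ℕ} (hs : 1 ≤ s)
    (hsJ : s ≤ J) :
    PadicOrdGe p (laiPhiDiv J r M n δ k p - (J - s : ℕ)) (laiC J r M n δ * c (s - 1) k) := by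
  have hp2' : (M - 2 * dmin) * n < p ^ 2 := lt_of_le_of_lt (Nat.mul_le_mul_right n (Nat.sub_le _ _)) hp2
  have hkM : k ≤ M * n := hk₂.trans (Nat.mul_le_mul_right n (Nat.sub_le M dmin))
  have h := (laiG_isDOrd J r M n δ hδ dmin hmin h2 hp2' hk₁ hk₂ (J - 1)).padicOrdGe_divDeriv
    (show J - 1 < p by omega) (j := J - s) (by omega)
  rw [divDeriv_laiG_eq J r M n δ hδ hM hc hkM (a := J - s) (by omega), laiBrickExp_eq_laiPhiDiv J r M n δ hδ,
    show J - 1 - (J - s) = s - 1 by omega] at h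
  exact h

/-- Numerator bound at a prime of `Φ_e`, `1 ≤ s ≤ J`: `ord_p (C_n ∏_j D_{M_j n} Σ_k c_{s−1,k}) ≥ e n p + s`. [this file] -/
theorem lai_num_padicOrdGe (J r M n : ℕ) (δ : Fin J → ℕ) (hδ : ∀ j, 2 * δ j ≤ M) (hM : 0 < M) {c : ℕ → ℕ → ℚ}
    (hc : ∀ t : ℚ, (∀ p : ℕ, p ≤ M * n → t + p + 1 ≠ 0) →
      BallRivoal.pfEval (M * n) J c t =
        ((laiPoly J r M n δ).comp (X + C 1)).eval t / BallRivoal.poch (t + 1) (M * n + 1) ^ J)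
    (dmin : ℕ) (hmin : ∀ j, dmin ≤ δ j) (h2 : 2 * dmin < M) (e : ℕ → ℕ → ℕ) {p : ℕ} [hp : Fact p.Prime]
    (he : ∀ k, dmin * n ≤ k → k ≤ (M - dmin) * n → ((e n p : ℕ) : ℤ) ≤ laiPhiDiv J r M n δ k p)
    (hJp : J ≤ p) (hp1 : p ≤ (M - 2 * dmin) * n) (hp2 : M * n < p ^ 2) {s : ℕ} (hs : 1 ≤ s) (hsJ : s ≤ J) :
    PadicOrdGe p ((e n p : ℤ) + s)
      (laiC J r M n δ * (∏ j, ((Nat.lcmUpto (max (M - 2 * dmin) (M - δ j) * n) : ℕ) : ℚ)) *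
        ∑ k ∈ range (M * n + 1), c (s - 1) k) := by
  have hD := lai_padicOrdGe_blockDenom J M n δ dmin hp1 hp2
  have hS : PadicOrdGe p ((e n p : ℤ) - (J - s : ℕ))
      (∑ k ∈ range (M * n + 1), laiC J r M n δ * c (s - 1) k) := by
    refine PadicOrdGe.sum fun k hk => ?_
    have hkM : k ≤ M * n := Nat.lt_succ_iff.1 (mem_range.1 hk)
    by_cases hw : dmin * n ≤ k ∧ k ≤ (M - dmin) * n
    · have h1 := lai_pf_padicOrdGe J r M n δ hδ hM hc dmin hmin h2 hJp hp2 hw.1 hw.2 hs hsJ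
      have h3 := he k hw.1 hw.2
      exact h1.mono (by omega)
    · have h0 : c (s - 1) k = 0 :=
        lai_pf_eq_zero_off_window J r M n δ hδ hM hc dmin hmin hkM (by omega) (o := s - 1) (by omega)
      rw [h0, mul_zero]
      exact PadicOrdGe.zero _
  have heq : laiC J r M n δ * (∏ j, ((Nat.lcmUpto (max (M - 2 * dmin) (M - δ j) * n) : ℕ) : ℚ)) *
        ∑ k ∈ range (M * n + 1), c (s - 1) k =
      (∏ j, ((Nat.lcmUpto (max (M - 2 * dmin) (M - δ j) * n) : ℕ) : ℚ)) *
        ∑ k ∈ range (M * n + 1), laiC J r M n δ * c (s - 1) k := by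
    rw [mul_sum, mul_sum]
    exact sum_congr rfl fun k _ => by ring
  rw [heq]
  exact (hD.mul hS).mono (by omega)

/-- Numerator bound at a prime of `Φ_e`, `s = 0` (sorted `δ`): `ord_p (C_n ∏_j D_{M_j n} Σ_{o,k} c_{o,k}H_k^{(o+1)}) ≥ e n p`
(a non-zero `c_{o,k}` lies in block `o+1`, `ord_p(C_n c_{o,k}) ≥ e − (J−1−o)`, `ord_p H_k^{(o+1)} ≥ −(o+1)` as `k < p²`,
`ord_p ∏ D = J`). [cite: Lai2024BallRivoal, Lemma 4.4] -/
theorem lai_num0_padicOrdGe (J r M n : ℕ) (δ : Fin J → ℕ) (hδ : ∀ j, 2 * δ j ≤ M) (hM : 0 < M) (hmono : Monotone δ)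
    {c : ℕ → ℕ → ℚ}
    (hc : ∀ t : ℚ, (∀ p : ℕ, p ≤ M * n → t + p + 1 ≠ 0) →
      BallRivoal.pfEval (M * n) J c t =
        ((laiPoly J r M n δ).comp (X + C 1)).eval t / BallRivoal.poch (t + 1) (M * n + 1) ^ J)
    (dmin : ℕ) (hmin : ∀ j, dmin ≤ δ j) (h2 : 2 * dmin < M) (e : ℕ → ℕ → ℕ) {p : ℕ} [hp : Fact p.Prime]
    (he : ∀ k, dmin * n ≤ k → k ≤ (M - dmin) * n → ((e n p : ℕ) : ℤ) ≤ laiPhiDiv J r M n δ k p)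
    (hJp : J ≤ p) (hp1 : p ≤ (M - 2 * dmin) * n) (hp2 : M * n < p ^ 2) :
    PadicOrdGe p (e n p : ℤ)
      (laiC J r M n δ * (∏ j, ((Nat.lcmUpto (max (M - 2 * dmin) (M - δ j) * n) : ℕ) : ℚ)) *
        ∑ o ∈ range J, ∑ k ∈ range (M * n + 1), c o k * harm (o + 1) k) := by
  have hD := lai_padicOrdGe_blockDenom J M n δ dmin hp1 hp2
  have hS : PadicOrdGe p ((e n p : ℤ) - J)
      (∑ o ∈ range J, ∑ k ∈ range (M * n + 1), laiC J r M n δ * c o k * harm (o + 1) k) := by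
    refine PadicOrdGe.sum fun o ho => PadicOrdGe.sum fun k hk => ?_
    have ho' := mem_range.1 ho
    have hkM : k ≤ M * n := Nat.lt_succ_iff.1 (mem_range.1 hk)
    by_cases hne : c o k = 0
    · rw [hne, mul_zero, zero_mul]
      exact PadicOrdGe.zero _
    obtain ⟨hk1, hk2⟩ := lai_pf_mem_block J r M n δ hδ hM hmono hc hkM ho' hne
    have hw1 : dmin * n ≤ k := (Nat.mul_le_mul_right n (hmin _)).trans hk1
    have hw2 : k ≤ (M - dmin) * n := hk2.trans (Nat.mul_le_mul_right n (Nat.sub_le_sub_left (hmin _) M))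
    have h1 := lai_pf_padicOrdGe J r M n δ hδ hM hc dmin hmin h2 hJp hp2 hw1 hw2 (s := o + 1) (by omega)
      (by omega)
    rw [Nat.add_sub_cancel] at h1
    have h3 := padicOrdGe_harm (p := p) (o + 1) k
    have hlog : padicValNat p (Nat.lcmUpto k) ≤ 1 :=
      Zudilin2004.padicValNat_lcmUpto_le_one (lt_of_le_of_lt hkM hp2)
    have h4 := he k hw1 hw2
    have hcast : (((o + 1) * padicValNat p (Nat.lcmUpto k) : ℕ) : ℤ) ≤ ((o + 1 : ℕ) : ℤ) := by
      exact_mod_cast (Nat.mul_le_mul_left (o + 1) hlog).trans (by simp)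
    exact (h1.mul h3).mono (by push_cast at hcast ⊢; omega)
  have heq : laiC J r M n δ * (∏ j, ((Nat.lcmUpto (max (M - 2 * dmin) (M - δ j) * n) : ℕ) : ℚ)) *
        ∑ o ∈ range J, ∑ k ∈ range (M * n + 1), c o k * harm (o + 1) k =
      (∏ j, ((Nat.lcmUpto (max (M - 2 * dmin) (M - δ j) * n) : ℕ) : ℚ)) *
        ∑ o ∈ range J, ∑ k ∈ range (M * n + 1), laiC J r M n δ * c o k * harm (o + 1) k := by
    simp_rw [mul_sum]
    exact sum_congr rfl fun o _ => sum_congr rfl fun k _ => by ring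
  rw [heq]
  exact (hD.mul hS).mono (by omega)

/-- **`isInt` field with the saving factor**: for an admissible exponent table `e`,
`C_n · ∏_j D_{M_j n} · Φ_e(n)⁻¹ · laiCoef n s ∈ ℤ` for all `n, s` — the skeleton's `isInt` with `C n = laiC`,
`Dm j = max(M−2·dmin, M−δ_j)`, `Φ = laiPhiGen J M dmin e` (literally `normaliser C Dm Φ n * coef n s` unfolded).
[cite: Lai2024BallRivoal, Lemma 4.4] -/
theorem laiCoef_isInt_phi (J r M : ℕ) (δ : Fin J → ℕ) (hδ : ∀ j, 2 * δ j ≤ M) (hM : 0 < M) (hmono : Monotone δ)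
    (c : ℕ → ℕ → ℕ → ℚ)
    (hc : ∀ n : ℕ, ∀ t : ℚ, (∀ p : ℕ, p ≤ M * n → t + p + 1 ≠ 0) →
      BallRivoal.pfEval (M * n) J (c n) t =
        ((laiPoly J r M n δ).comp (X + C 1)).eval t / BallRivoal.poch (t + 1) (M * n + 1) ^ J)
    (dmin : ℕ) (hmin : ∀ j, dmin ≤ δ j) (h2 : 2 * dmin < M) (e : ℕ → ℕ → ℕ)
    (hadm : LaiExpAdmissible J r M δ dmin e) (n s : ℕ) :
    ∃ z : ℤ, (z : ℚ) = laiC J r M n δ * ((∏ j, Nat.lcmUpto (max (M - 2 * dmin) (M - δ j) * n) : ℕ) : ℚ)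
      / (laiPhiGen J M dmin e n : ℚ) * laiCoef J M c n s := by
  obtain ⟨x, hx⟩ := laiCoef_isInt J r M δ hδ hM hmono c hc dmin hmin h2 n s
  suffices h : ∃ z : ℤ, (x : ℚ) / (laiPhiGen J M dmin e n : ℚ) = z by
    obtain ⟨z, hz⟩ := h
    refine ⟨z, ?_⟩
    rw [← hz, hx]
    push_cast
    ring
  refine Rat.exists_int_of_padicOrdGe fun p hp => ?_
  haveI := Fact.mk hp
  rw [div_eq_mul_inv]
  have hv := padicValNat_laiPhiGen J M dmin e n p
  have hinv := Zudilin2004.padicOrdGe_inv_natCast (p := p) (laiPhiGen J M dmin e n)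
  by_cases hP : J ≤ p ∧ p ≤ (M - 2 * dmin) * n ∧ M * n < p ^ 2
  · rw [if_pos hP] at hv
    rw [hv] at hinv
    have he : ∀ k, dmin * n ≤ k → k ≤ (M - dmin) * n → ((e n p : ℕ) : ℤ) ≤ laiPhiDiv J r M n δ k p :=
      fun k hk1 hk2 => hadm n p k hp hP.1 hP.2.1 hP.2.2 hk1 hk2
    have hnum : PadicOrdGe p (e n p : ℤ) (x : ℚ) := by
      rw [hx]
      rcases Nat.eq_zero_or_pos s with rfl | hs
      · have h0 : laiCoef J M c n 0 = -∑ o ∈ range J, ∑ k ∈ range (M * n + 1), c n o k * harm (o + 1) k := by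
          simp [laiCoef]
        rw [h0, mul_neg]
        exact padicOrdGe_neg (lai_num0_padicOrdGe J r M n δ hδ hM hmono (hc n) dmin hmin h2 e he hP.1 hP.2.1 hP.2.2)
      by_cases hsJ : s ≤ J
      · have h1 : laiCoef J M c n s = ∑ k ∈ range (M * n + 1), c n (s - 1) k := by
          simp [laiCoef, show s ≠ 0 by omega, hsJ]
        rw [h1]
        exact (lai_num_padicOrdGe J r M n δ hδ hM (hc n) dmin hmin h2 e he hP.1 hP.2.1 hP.2.2 hs hsJ).mono
          (by omega)
      · have h1 : laiCoef J M c n s = 0 := by simp [laiCoef, show s ≠ 0 by omega, hsJ]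
        rw [h1, mul_zero]
        exact PadicOrdGe.zero _
    simpa using hnum.mul hinv
  · rw [if_neg hP] at hv
    rw [hv] at hinv
    simpa using (PadicOrdGe.of_int x).mul hinv

/-- **`dvd3` field with the saving factor**: for an admissible table, `3 ≤ J` and `3 ≤ s`,
`C_n · ∏_j D_{M_j n} · Φ_e(n)⁻¹ · laiCoef n s ∈ D_{(M−δ₂)n}^3 ℤ` (Lai's `γ₁`: `ord_p D_{(M−δ₂)n} ≤ 1 ≤ s/3` at the primes
of `Φ_e`). [cite: Lai2024BallRivoal, §13 (proof of Claim 1.4)] -/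
theorem laiCoef_dvd3_phi (J r M : ℕ) (δ : Fin J → ℕ) (hδ : ∀ j, 2 * δ j ≤ M) (hM : 0 < M) (hmono : Monotone δ)
    (hJ3 : 3 ≤ J) (c : ℕ → ℕ → ℕ → ℚ)
    (hc : ∀ n : ℕ, ∀ t : ℚ, (∀ p : ℕ, p ≤ M * n → t + p + 1 ≠ 0) →
      BallRivoal.pfEval (M * n) J (c n) t =
        ((laiPoly J r M n δ).comp (X + C 1)).eval t / BallRivoal.poch (t + 1) (M * n + 1) ^ J)
    (dmin : ℕ) (hmin : ∀ j, dmin ≤ δ j) (h2 : 2 * dmin < M) (e : ℕ → ℕ → ℕ)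
    (hadm : LaiExpAdmissible J r M δ dmin e) (n s : ℕ) (hs : 3 ≤ s) :
    ∃ z : ℤ, (z : ℚ) * ((Nat.lcmUpto ((M - δ ⟨2, by omega⟩) * n) ^ 3 : ℕ) : ℚ) =
      laiC J r M n δ * ((∏ j, Nat.lcmUpto (max (M - 2 * dmin) (M - δ j) * n) : ℕ) : ℚ)
        / (laiPhiGen J M dmin e n : ℚ) * laiCoef J M c n s := by
  obtain ⟨w, hw⟩ := laiCoef_dvd3 J r M δ hδ hM hmono hJ3 c hc dmin hmin h2 n s hs
  have hE : 0 < Nat.lcmUpto ((M - δ ⟨2, by omega⟩) * n) := Nat.lcmUpto_pos _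
  have hE0 : ((Nat.lcmUpto ((M - δ ⟨2, by omega⟩) * n) ^ 3 : ℕ) : ℚ) ≠ 0 := by positivity
  suffices h : ∃ z : ℤ, (w : ℚ) / (laiPhiGen J M dmin e n : ℚ) = z by
    obtain ⟨z, hz⟩ := h
    refine ⟨z, ?_⟩
    rw [← hz, div_mul_eq_mul_div, hw]
    push_cast
    ring
  refine Rat.exists_int_of_padicOrdGe fun p hp => ?_
  haveI := Fact.mk hp
  rw [div_eq_mul_inv]
  have hv := padicValNat_laiPhiGen J M dmin e n p
  have hinv := Zudilin2004.padicOrdGe_inv_natCast (p := p) (laiPhiGen J M dmin e n)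
  by_cases hP : J ≤ p ∧ p ≤ (M - 2 * dmin) * n ∧ M * n < p ^ 2
  · rw [if_pos hP] at hv
    rw [hv] at hinv
    have he : ∀ k, dmin * n ≤ k → k ≤ (M - dmin) * n → ((e n p : ℕ) : ℤ) ≤ laiPhiDiv J r M n δ k p :=
      fun k hk1 hk2 => hadm n p k hp hP.1 hP.2.1 hP.2.2 hk1 hk2
    have hwv : PadicOrdGe p (e n p : ℤ) (w : ℚ) := by
      by_cases hsJ : s ≤ J
      · have hnum := lai_num_padicOrdGe J r M n δ hδ hM (hc n) dmin hmin h2 e he hP.1 hP.2.1 hP.2.2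
          (s := s) (by omega) hsJ
        have h1 : laiCoef J M c n s = ∑ k ∈ range (M * n + 1), c n (s - 1) k := by
          simp [laiCoef, show s ≠ 0 by omega, hsJ]
        have hw' : (w : ℚ) = (laiC J r M n δ * (∏ j, ((Nat.lcmUpto (max (M - 2 * dmin) (M - δ j) * n) : ℕ) : ℚ)) *
            ∑ k ∈ range (M * n + 1), c n (s - 1) k) *
              (((Nat.lcmUpto ((M - δ ⟨2, by omega⟩) * n) ^ 3 : ℕ) : ℚ))⁻¹ := by
          rw [eq_mul_inv_iff_mul_eq₀ hE0, hw, h1]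
        have hEinv : PadicOrdGe p (-3) ((((Nat.lcmUpto ((M - δ ⟨2, by omega⟩) * n) ^ 3 : ℕ) : ℚ)))⁻¹ := by
          refine Or.inr ?_
          rw [padicValRat.inv, Nat.cast_pow, padicValRat.pow, padicValRat.of_nat]
          have hle : padicValNat p (Nat.lcmUpto ((M - δ ⟨2, by omega⟩) * n)) ≤ 1 :=
            Zudilin2004.padicValNat_lcmUpto_le_one
              (lt_of_le_of_lt (Nat.mul_le_mul_right n (Nat.sub_le _ _)) hP.2.2)
          have hle' : (padicValNat p (Nat.lcmUpto ((M - δ ⟨2, by omega⟩) * n)) : ℤ) ≤ 1 := by exact_mod_cast hle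
          push_cast
          linarith
        rw [hw']
        exact (hnum.mul hEinv).mono (by omega)
      · have h1 : laiCoef J M c n s = 0 := by simp [laiCoef, show s ≠ 0 by omega, hsJ]
        have hw0 : (w : ℚ) = 0 := by
          rw [h1, mul_zero] at hw
          exact (mul_eq_zero.1 hw).resolve_right hE0
        rw [hw0]
        exact PadicOrdGe.zero _
    simpa using hwv.mul hinv
  · rw [if_neg hP] at hv
    rw [hv] at hinv
    simpa using (PadicOrdGe.of_int w).mul hinv

end Saving

end Summit.KontsevichZagierPeriods.Zeta5Search

end
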